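import Summits.HodgeConjecture.HodgeConjecture.Theorems.Ring2AbelianAllWeilCellsAnchorPointed
import Summits.HodgeConjecture.HodgeConjecture.Theorems.Ring2AbelianAllWeilCellsAnchored
import Summits.HodgeConjecture.HodgeConjecture.Theorems.Ring2HypothesesWeilComponents
import Summits.HodgeConjecture.HodgeConjecture.Theorems.AnchorTransportVariationalHodgeTrivialFamily
import Literature.AlgebraicGeometry.HodgeTheory.QuasiProjectiveOfAffine
import Literature.AlgebraicGeometry.HodgeTheory.MotivatedClassesDeformationCurves
import Literature.AlgebraicGeometry.HodgeTheory.WeilTypeAbelianVariety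
import Literature.AlgebraicGeometry.Motives.SegreHyperplaneClass
import Literature.NumberTheory.EllipticCurves.CMEndomorphismOfMulMemLattice
import HarnessLib

/-!
# N73 `IsogenyConnectedToCMAnchor n d δ` holds FACT-FREE at the members isogenous to the CM tower (constant family),
# and is jointly satisfiable on every right-sign cell

SUPPORT file for item stmt-HodgeConjecture-19825 (`SplitImpliesAll.NonsplitCellsConnected` = N73 on the non-split
right-sign sixfold cells; crux rank 4, labelled IN PRINT). Route-independent (no `Theses` import): two kernel facts about
ring 2's anchor-pointed leaf `Ring2.AbelianAll.IsogenyConnectedToCMAnchor n d δ =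
PointedWeilFamiliesComponent n d δ (cmTowerAnchor n d)` (`Theorems/Ring2AbelianAllWeilCellsAnchorPointed`, whose
docstring records «No on-path lemma: under HC the constant family does not reach the CM tower»).

* `isogenyConnectedToCMAnchor_witness_of_isIsogenous_cmTower` — **the fact-free part.** At every polarized member
  `(A, φ, h_K(e,a))` of a cell `(n, d, δ)` that IS isogenous to the cell's CM tower (an abelian variety of CM type all of
  whose `(1,0)`-classes are pulled back from ONE elliptic curve `E₀` with `ψ₀² = -d`), N73's `∃`-block holds for every
  rational `(n,n)` Weil class `c`, witnessed by the CONSTANT family `A.X ⟶ Spec ℂ` (both marked points the point of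
  `Spec ℂ`, global class `c`, every fibre charted by `(A, φ, e, a)` itself): no moduli space, no named fact. So the
  print input the item is derived from (J1, `Theorems/SplitImpliesAllNonsplitCellsConnectedOfJ1`) is needed exactly at
  the members NOT isogenous to the CM tower.
* `isogenyConnectedToCMAnchor_inhabited` — **anti-vacuity on every right-sign cell.** For `n, d ≥ 1` and
  `sign δ = (-1)ⁿ` the hypotheses of N73 AND its `∃`-block (smooth projective family over a smooth irreducible
  quasi-projective base, fibrewise rational `(n,n)` global class, `HasWeilChartsOfDisc n d δ`, the chart equation,
  `cmTowerAnchor`) are met together at the CM-tower member of exact class `δ` (`exists_cmMember` over the curve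
  `ℂ/ℤ[√-d]` of `exists_cmCurve_sqrt_neg`), for EVERY rational `(n,n)` Weil class of that member.

HONEST STATUS: nothing here is a case of the Hodge conjecture; HC / HC_CM / HC_AV are NOT proved; the item stays OPEN.
-/

noncomputable section
set_option linter.dupNamespace false

open CategoryTheory AlgebraicGeometry
open Literature.AlgebraicGeometry Literature.AlgebraicGeometry.Motives
open Literature.AlgebraicGeometry.Motives.SegreHyperplaneClass
open Literature.AlgebraicGeometry.HodgeTheory
open Literature.AlgebraicGeometry.Milne1999 (IsOfCMType)
open Literature.AlgebraicGeometry.VanGeemen1994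
open Literature.AlgebraicTopology.SingularHomology
open Summit.HodgeConjecture.HodgeConjecture.Ring2.Hypotheses
open Summit.HodgeConjecture.HodgeConjecture.Ring2.AbelianAll
open Summit.HodgeConjecture.HodgeConjecture.Theorems (isSmoothProjectiveFamily_toSpecOver' isIso_fiberι_toSpecOver')

namespace Summit.HodgeConjecture.HodgeConjecture.Theorems.SplitImpliesAllIsogenyConnectedToCMAnchorConstantFamily

variable {n d : ℕ}

/-- **N73's `∃`-block at a member ISOGENOUS TO THE CM TOWER, fact-free.** For a polarized member `(A, φ, h_K(e,a))` of
the cell `(n, d, δ)` (`dim A = 2n`, `φ² = -d`, `a ≠ 0` rational, `det H = δ` non-degenerate) and a rational `(n,n)`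
class `c` of its Weil plane: if `A` is isogenous to an abelian variety `B` of CM type whose `(1,0)`-classes are pulled
back from ONE elliptic curve `E₀` with `ψ₀² = -d` (the CM tower of the cell and its isogenes), then the conclusion of
`IsogenyConnectedToCMAnchor n d δ` holds at `(A, c)`: the CONSTANT family `A.X ⟶ Spec ℂ` (smooth projective; base
`Spec ℂ` smooth, irreducible, quasi-projective), both marked points the point of `Spec ℂ`, global class `c`, every fibre
charted by `(A, φ, e, a)` itself (so `HasWeilChartsOfDisc n d δ`), and the CM-tower anchor met through the chart
`A.X ≅ 𝒳_s` by `A ~ B`. UNCONDITIONAL; no moduli space is used. [cite: vanGeemen1994HodgeAV, 5.3 and Lemma 5.2 (3)]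
[cite: Deligne1982HodgeCycles, §4, proof of Thm. 4.8 (b)] -/
theorem isogenyConnectedToCMAnchor_witness_of_isIsogenous_cmTower {δ : weilNormResidueGroup d}
    {A : AbelianVariety ℂ} {φ : A ⟶ A} (hAdim : A.dim = 2 * n) (hX : IsSmoothProjective (2 * n) A.X)
    (hφ : φ ≫ φ = -(d • 𝟙 A)) (e : ProjectiveEmbedding A.X) (a : complexBetti (projectiveSpace e.n ℂ) 2)
    (haQ : IsRationalClass a) (ha0 : a ≠ 0)
    (hδ : HasWeilDiscriminantNondeg A φ n d
      ((d : ℂ) • complexBetti.map e.ι 2 a + complexBetti.map φ.hom.hom.hom 2 (complexBetti.map e.ι 2 a)) δ)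
    (c : complexBetti A.X (2 * n)) (hcQ : IsRationalClass c) (hcH : IsOfHodgeType (2 * n) A.X (2 * n) n n c)
    (hc : c ∈ weilClassesOf A φ n d)
    {E₀ : AbelianVariety ℂ} {ψ₀ : E₀ ⟶ E₀} {B : AbelianVariety ℂ} (hE : E₀.dim = 1)
    (hψ : ψ₀ ≫ ψ₀ = -(d • 𝟙 E₀)) (hiso : A.IsIsogenous B) (hcm : IsOfCMType B)
    (hgen : ∀ u : complexBetti B.X 1, IsOfHodgeType B.dim B.X 1 1 0 u →
      u ∈ Submodule.span ℂ {y : complexBetti B.X 1 | ∃ (g : B ⟶ E₀) (w : complexBetti E₀.X 1),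
        IsOfHodgeType E₀.dim E₀.X 1 1 0 w ∧ y = complexBetti.map g.hom.hom.hom 1 w}) :
    ∃ (𝒳 S : SchemeOver ℂ) (f : 𝒳 ⟶ S) (s₁ s₀ : ComplexPoints S) (ι : A.X ≅ fiberOver f s₁)
        (W : complexBetti 𝒳 (2 * n)),
      IsSmoothProjectiveFamily f (2 * n) ∧ IsQuasiProjectiveOver 𝒳 ∧ IsQuasiProjectiveOver S ∧
      IrreducibleSpace S.left ∧ AlgebraicGeometry.Smooth S.hom ∧
      (∀ s : ComplexPoints S,
        IsRationalClass (complexBetti.map (fiberι f s) (2 * n) W) ∧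
          IsOfHodgeType (2 * n) (fiberOver f s) (2 * n) n n (complexBetti.map (fiberι f s) (2 * n) W)) ∧
      HasWeilChartsOfDisc n d δ f W ∧
      complexBetti.map ι.hom (2 * n) (complexBetti.map (fiberι f s₁) (2 * n) W) = c ∧
      cmTowerAnchor n d (fiberOver f s₀) (complexBetti.map (fiberι f s₀) (2 * n) W) := by
  have hfam : IsSmoothProjectiveFamily (toSpecOver A.X) (2 * n) := isSmoothProjectiveFamily_toSpecOver' hX
  let s : ComplexPoints (specOver ℂ ℂ) := 𝟙 (specOver ℂ ℂ)
  haveI : ∀ t : ComplexPoints (specOver ℂ ℂ), IsIso (fiberι (toSpecOver A.X) t) :=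
    fun t => isIso_fiberι_toSpecOver' (X := A.X) t
  let ι : A.X ≅ fiberOver (toSpecOver A.X) s := (asIso (fiberι (toSpecOver A.X) s)).symm
  have hback : ∀ t : ComplexPoints (specOver ℂ ℂ),
      complexBetti.map (asIso (fiberι (toSpecOver A.X) t)).symm.hom (2 * n)
        (complexBetti.map (fiberι (toSpecOver A.X) t) (2 * n) c) = c := fun t => by
    change (complexBetti.map (asIso (fiberι (toSpecOver A.X) t)).hom (2 * n) ≫
      complexBetti.map (asIso (fiberι (toSpecOver A.X) t)).inv (2 * n)) c = c
    rw [← complexBetti.map_comp, Iso.inv_hom_id, complexBetti.map_id]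
    rfl
  refine ⟨A.X, specOver ℂ ℂ, toSpecOver A.X, s, s, ι, c, hfam,
    IsQuasiProjectiveOver.of_isProjectiveOver hX.isProjectiveOver, IsQuasiProjectiveOver.specOver,
    inferInstanceAs (IrreducibleSpace (PrimeSpectrum ℂ)), ?_, ?_, ?_, hback s, ?_⟩
  · haveI : IsIso (specOver ℂ ℂ).hom := by rw [specOver_hom_eq_id]; exact IsIso.id _
    infer_instance
  · intro t
    exact ⟨hcQ.pullback _, IsOfHodgeType.map_of_iso (asIso (fiberι (toSpecOver A.X) t)) hcH⟩
  · intro t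
    refine ⟨A, φ, (asIso (fiberι (toSpecOver A.X) t)).symm, hAdim, hφ, ?_, e, a, haQ, ha0, hδ⟩
    rw [hback t]
    exact hc
  · exact ⟨A, ⟨(asIso (fiberι (toSpecOver A.X) s)).symm⟩, hAdim, E₀, ψ₀, B, hE, hψ, hiso, hcm, hgen⟩

/-- **N73 is jointly satisfiable on every right-sign cell, fact-free.** For `n, d ≥ 1` and every class `δ` with
`sign δ = (-1)ⁿ` there is a polarized member `(A, φ, h_K(e,a))` OF THE CELL (exact class `δ`), of Weil type `(n,n)`
(so carrying non-zero rational `(n,n)` Weil classes, `exists_weilClass_of_isWeilType`), at which the hypotheses of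
`IsogenyConnectedToCMAnchor n d δ` are met and its `∃`-block holds for EVERY rational `(n,n)` Weil class `c`: the
CM-tower member of exact class `δ` (`exists_cmMember`, over the curve `E₀ = ℂ/ℤ[√-d]` of `exists_cmCurve_sqrt_neg`)
with the constant family (`A ~ A`). So the typed far end, the typed charts `HasWeilChartsOfDisc n d δ` and the typed
family clauses are consistent with the cell's hypotheses; what the leaf asks beyond this is a NON-constant family at the
members not isogenous to the tower. UNCONDITIONAL. [cite: vanGeemen1994HodgeAV, 4.11, 4.14, 5.3 and Lemma 5.2 (4)] -/
theorem isogenyConnectedToCMAnchor_inhabited (hn : 0 < n) (hd : 0 < d) {δ : weilNormResidueGroup d}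
    (hδ : weilSign d δ = (-1) ^ n) :
    ∃ (A : AbelianVariety ℂ) (φ : A ⟶ A) (e : ProjectiveEmbedding A.X) (a : complexBetti (projectiveSpace e.n ℂ) 2),
      A.dim = 2 * n ∧ IsSmoothProjective (2 * n) A.X ∧ φ ≫ φ = -(d • 𝟙 A) ∧ IsRationalClass a ∧ a ≠ 0 ∧
      HasWeilDiscriminantNondeg A φ n d
        ((d : ℂ) • complexBetti.map e.ι 2 a + complexBetti.map φ.hom.hom.hom 2 (complexBetti.map e.ι 2 a)) δ ∧
      IsWeilType A φ n d ∧
      ∀ c : complexBetti A.X (2 * n), IsRationalClass c → IsOfHodgeType (2 * n) A.X (2 * n) n n c →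
        c ∈ weilClassesOf A φ n d →
        ∃ (𝒳 S : SchemeOver ℂ) (f : 𝒳 ⟶ S) (s₁ s₀ : ComplexPoints S) (ι : A.X ≅ fiberOver f s₁)
            (W : complexBetti 𝒳 (2 * n)),
          IsSmoothProjectiveFamily f (2 * n) ∧ IsQuasiProjectiveOver 𝒳 ∧ IsQuasiProjectiveOver S ∧
          IrreducibleSpace S.left ∧ AlgebraicGeometry.Smooth S.hom ∧
          (∀ s : ComplexPoints S,
            IsRationalClass (complexBetti.map (fiberι f s) (2 * n) W) ∧
              IsOfHodgeType (2 * n) (fiberOver f s) (2 * n) n n (complexBetti.map (fiberι f s) (2 * n) W)) ∧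
          HasWeilChartsOfDisc n d δ f W ∧
          complexBetti.map ι.hom (2 * n) (complexBetti.map (fiberι f s₁) (2 * n) W) = c ∧
          cmTowerAnchor n d (fiberOver f s₀) (complexBetti.map (fiberι f s₀) (2 * n) W) := by
  obtain ⟨g, hgr, hgnz, hgσ⟩ := exists_segreHyperplaneClasses
  obtain ⟨E₀, ψ₀, hE, hψ⟩ := Literature.NumberTheory.EllipticCurves.CMEndomorphism.exists_cmCurve_sqrt_neg d hd
  obtain ⟨A, φ, e, hW, hen, hN, -, hgen, hcm⟩ := exists_cmMember g hgr hgnz hgσ hE hd hψ hn hδ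
  refine ⟨A, φ, e, g e.n, hW.dim_eq, hW.isSmoothProjective, hW.sq_eq, hgr _, hgnz _ hen, hN, hW, ?_⟩
  intro c hcQ hcH hc
  exact isogenyConnectedToCMAnchor_witness_of_isIsogenous_cmTower hW.dim_eq hW.isSmoothProjective hW.sq_eq e (g e.n)
    (hgr _) (hgnz _ hen) hN c hcQ hcH hc hE hψ (AbelianVariety.IsIsogenous.refl A) hcm hgen

end Summit.HodgeConjecture.HodgeConjecture.Theorems.SplitImpliesAllIsogenyConnectedToCMAnchorConstantFamily

end
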